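import Summits.HodgeConjecture.HodgeConjecture.Theorems.Ring2HypothesesLandherrRebase
import Summits.HodgeConjecture.HodgeConjecture.Theorems.Ring2HypothesesWeilComponentsGerm
import Summits.HodgeConjecture.HodgeConjecture.Theorems.Ring2HypothesesCMPowerAnchors
import Summits.HodgeConjecture.HodgeConjecture.Theorems.Ring2TransportWeilTypeGeneralDischarged
import HarnessLib

/-!
# Ring 2 — hypotheses layer, part XXXII: the van Geemen 6.12 BINDER LEDGER of the hypotheses axis — the seventeen `h612` rows of parts VII-B / XI-A / VIII / XIII / XXX-C binder-free, and the `n = 1` column outright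

HONEST FRAMING: research route conditional on HC_CM; not a corollary; Q11.4-sentence-2 already refuted in dim ≥ 3.

Cell `pub-hodge-ring2`, seat `pub-hodge-ring2-typer2`, gen 26. `HC_CM` is ALWAYS the binder
`(hCM : Theses.RankFourFaces.CMAbelianHodge)` (stmt-HodgeConjecture-3052), never an axiom, never cited as known.
Nothing here proves a new case of the Hodge conjecture: every row is an implication between NAMED typed statements of
the tree, or (§3) the unconditional `n = 1` column, which is `dim A = 2 ≤ 3`. Sorry-free; axioms `propext`,
`Classical.choice`, `Quot.sound`.

## Why this file exists (count once — LEAD L24.3 (iii) / L24.7)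

Seventeen theorems of this axis carry the binder `(h612 : VanGeemen1994_thm612)` — van Geemen's Thm. 6.12 (Weil 1977:
on the general member `Hg = SU_H` of a Weil-type family, `B• = ⟨D¹, W_K⟩`) typed for every `0 < n`. The literature
seat PROVED the statement on the carriers for every `2 ≤ n` (`VanGeemen1994_thm612_corrected_holds`,
`Literature/AlgebraicGeometry/VanGeemen1994/WeilTypeHodgeRingOfSU.lean`) and flagged the `0 < n` typing as MISSTATED
at `n = 1` (on a Weil-type abelian surface `D¹ ⊗ ℂ = B¹ ⊗ ℂ ⊇ W_K ⊗ ℂ ≠ 0` contradicts the `Disjoint` conjunct; vG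
Thm. 4.11 carries "(with n > 1)"). So `h612` is a hypothesis nobody can ever supply, while everything it was used for
holds outright: all seventeen rows funnel through ONE call, part VII-B's
`hodgeGeneralWeilTypeComponent_of_weilClassesComponent` → the transport seat's slice
`Ring2Transport.hodgeConjectureFor_of_hasHodgeGroupSU_of_weilClasses`, whose binder-free twin
`…_discharged` (`Ring2TransportWeilTypeGeneralDischarged`, transport gen 22) uses the proved `2 ≤ n` statement and
`dim ≤ 3` at `n = 1`. Landed signatures are never edited in place (the paper's by-name index and every call site would
break), so — exactly as for the Landherr binder (part XXX-C) — each row gets an ADDITIVE twin `<name>_discharged` with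
the SAME statement minus `h612`; the gen-5…21 theorems stay as they are (each is implied by its twin).

## Ledger (17 rows; `hAbd` = PW0 `UsualHodgePowersOfGeneralWeilType`, Abdulali, typed; `hL` = `LandherrSplitCriterion`, a THEOREM since part XXX-C)

| # | twin (this file) | of (part, file) | binders left |
|---|---|---|---|
| 1 | `hodgeGeneralWeilTypeComponent_of_weilClassesComponent_discharged` | VII-B W6, `…WeilComponentsLadder` | `W(δ)` |
| 2 | `HC_GeneralWeilTypeComponent_of_HC_CM_discharged` | VII-B W6 | `HC_CM`, CM-pointed δ-families, `VHC(δ)` |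
| 3 | `hodgeGeneralWeilTypeComponent_of_divisorGeneratedCMPointed_discharged` | VII-B W6′ | div-gen CM-pointed δ-families, `VHC(δ)` |
| 4 | `hodgeGeneralWeilTypeComponent_of_HC_CM_local_discharged` | XI-A W6-loc, `…WeilComponentsGerm` | `HC_CM`, CM-pointed, local germ at CM fibres |
| 5 | `hodgeGeneralWeilTypeComponent_of_divisorGeneratedCMPointed_localCM_discharged` | XI-A W6′-loc | div-gen CM-pointed, local germ |
| 6 | `hodgeGeneralWeilTypeComponent_of_cmPowerPointed_discharged` | VIII W6‴, `…CMPowerAnchors` | CM-power-pointed δ-families, `VHC(δ)` |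
| 7 | `hodgePowersOfGeneralWeilTypeComponent_of_weilClassesComponent_discharged` | XIII PW2, `…WeilPowers` | `hAbd`, `W(δ)` |
| 8 | `HC_PowersOfGeneralWeilTypeComponent_of_HC_CM_discharged` | XIII PW3 | `HC_CM`, `hAbd`, CM-pointed, `VHC(δ)` |
| 9 | `hodgePowersOfGeneralWeilTypeComponent_of_divisorGeneratedCMPointed_discharged` | XIII PW3′ | `hAbd`, div-gen CM-pointed, `VHC(δ)` |
| 10 | `hodgePowersOfGeneralWeilTypeComponent_two_of_refereed_one_or_three_discharged` | XIII PW4 | `hAbd`, Koike 2004, Schoen 1998 (refereed facts) |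
| 11 | `hodgePowersOfGeneralWeilTypeComponent_split_three_three_of_schoen_discharged` | XIII PW5 | `hAbd`, `hL`, Schoen |
| 12 | `hodgePowersOfGeneralWeilTypeComponent_split_three_one_of_koike_discharged` | XIII PW5 | `hAbd`, `hL`, Koike |
| 13 | `hodgePowersOfGeneralWeilTypeComponent_split_three_of_markmanSixfolds_discharged` | XIII PW5 | `hAbd`, `hL`, F2 (UNREFEREED) |
| 14 | `hodgePowersOfGeneralWeilTypeComponent_two_of_markmanFourfolds_discharged` | XIII PW4′ | `hAbd`, F1 (UNREFEREED) |
| 15 | `hodgePowersOfGeneralWeilTypeComponent_split_three_three_of_schoen'_discharged` | XXX-C L3, `…LandherrRebase` | `hAbd`, Schoen |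
| 16 | `hodgePowersOfGeneralWeilTypeComponent_split_three_one_of_koike'_discharged` | XXX-C L4 | `hAbd`, Koike |
| 17 | `hodgePowersOfGeneralWeilTypeComponent_split_three_of_markmanSixfolds'_discharged` | XXX-C L5 | `hAbd`, F2 (UNREFEREED) |

After this file the LIVE `h612` binders of the hypotheses axis are 0 of 17 (the transport axis: 0 of 11 since
`Ring2TransportWeilTypeGeneralDischarged`). HONEST COLUMN, unchanged: on every T6(δ) / power row `HC_CM` is NOMINAL
(replaceable by divisor-generated or CM-power anchors); the content is the δ-restricted variational statement / the
local germ (OPEN) plus the family leaf, and for powers Abdulali's PW0 (a refereed theorem in print, typed, not proved in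
the tree). §3 adds the `n = 1` column of the δ-tables — `W(1, d, δ)` and `T6(1, d, δ)` hold OUTRIGHT (abelian surfaces,
`dim ≤ 3`), so the tables' open content starts at `n = 2`. WHAT THE KERNEL ROWS ADD about Hodge classes: NOTHING new —
implications, and two cells already inside the tree's unconditional `dim ≤ 3` theorem.

References: [vanGeemen1994HodgeAV] B. van Geemen, LNM 1594 (1994), Thm. 4.11 ("with n > 1", PDF p. 219), Lemma 5.2,
(5.4.1), 5.5, Thm. 6.11–6.12 (PDF pp. 231–232); [Weil1977HodgeRing]; [Abdulali2016TateTwists] Thm. 4.1, App. A 1(b);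
[Schoen1998HodgeWeilAddendum]; [Koike2004WeilHodge] Thm. 2.1, Cor. 2.1; [Markman2025SecantWeil] arXiv:2502.03415
(UNREFEREED) Thm. 1.5.1, Cor. 1.6.1; [VoisinHodgeII2003] §10.2.3; [Deligne2000] §1.
-/

noncomputable section

set_option linter.dupNamespace false

open CategoryTheory
open Literature.AlgebraicGeometry Literature.AlgebraicGeometry.Motives Literature.AlgebraicGeometry.VanGeemen1994
open Literature.AlgebraicGeometry.HodgeTheory
open Literature.AlgebraicTopology.SingularHomology
open Summit.HodgeConjecture.HodgeConjecture.WeilTypeLadder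
open Summit.HodgeConjecture.HodgeConjecture.Theses
open Summit.HodgeConjecture.HodgeConjecture.Ring2Transport
open Summit.HodgeConjecture.HodgeConjecture.Ring2.AbelianAll (landherrSplitCriterion_holds)

namespace Summit.HodgeConjecture.HodgeConjecture.Ring2.Hypotheses

variable {n d : ℕ} {δ : weilNormResidueGroup d}

/-! ### §1 T6(δ): the general member of the component `(ℚ(√-d), 2n, δ)` — rows 1–6 -/

/-- **Row 1 — W6, binder-free: the component's Weil-class target gives the Hodge conjecture for its GENERAL member**
(`Hg = SU_H`): `Bᵖ = Dᵖ` (`p ≠ n`), `Bⁿ = Dⁿ ⊕ W_K` by the PROVED Thm. 6.12 for `n ≥ 2`, `dim ≤ 3` for `n = 1` — via the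
transport seat's binder-free slice. Twin of `hodgeGeneralWeilTypeComponent_of_weilClassesComponent`.
[cite: vanGeemen1994HodgeAV, Thm. 4.11 and Thm. 6.12] [cite: Weil1977HodgeRing] -/
theorem hodgeGeneralWeilTypeComponent_of_weilClassesComponent_discharged (hn : 0 < n) (hd : 0 < d)
    (hW : WeilClassesComponent n d δ) : HodgeGeneralWeilTypeComponent n d δ := by
  intro A φ e a hA hφ hWH ha ha0 hSU hδ
  have hX : IsSmoothProjective (2 * n) A.X := hA ▸ AbelianVariety.isSmoothProjective_holds (A := A)
  exact hodgeConjectureFor_of_hasHodgeGroupSU_of_weilClasses_discharged e hn hd hA hφ hWH ha ha0 hSU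
    (fun c hc hnn hw ↦ hW A φ hA hX hφ e a ha ha0 hδ c hc hnn hw)

/-- **Row 2 — `HC_<general member of (K, 2n, δ)>_of_HC_CM`, 6.12 discharged**: from `HC_CM`, CM-pointed δ-families
and the δ-restricted variational statement. CONDITIONAL on the three; `HC_CM` nominal (rows 3, 6). Twin of
`HC_GeneralWeilTypeComponent_of_HC_CM`. [cite: vanGeemen1994HodgeAV, Thm. 6.12] [cite: CharlesSchnell2014Notes, Conj. 11.3.1] -/
theorem HC_GeneralWeilTypeComponent_of_HC_CM_discharged (hCM : Theses.RankFourFaces.CMAbelianHodge) (hn : 0 < n)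
    (hd : 0 < d) (hP : CMPointedWeilFamiliesComponent n d δ) (hV : WeilVariationalHodgeComponent n d δ) :
    HodgeGeneralWeilTypeComponent n d δ :=
  hodgeGeneralWeilTypeComponent_of_weilClassesComponent_discharged hn hd (weilClassesComponent_of_HC_CM hCM hP hV)

/-- **Row 3 — W6′ WITHOUT `HC_CM`, 6.12 discharged** (divisor-generated CM-pointed δ-families). Twin of
`hodgeGeneralWeilTypeComponent_of_divisorGeneratedCMPointed`. [cite: vanGeemen1994HodgeAV, Thm. 6.12 and 5.5] -/
theorem hodgeGeneralWeilTypeComponent_of_divisorGeneratedCMPointed_discharged (hn : 0 < n) (hd : 0 < d)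
    (hP : DivisorGeneratedCMPointedWeilFamiliesComponent n d δ) (hV : WeilVariationalHodgeComponent n d δ) :
    HodgeGeneralWeilTypeComponent n d δ :=
  hodgeGeneralWeilTypeComponent_of_weilClassesComponent_discharged hn hd
    (weilClassesComponent_of_divisorGeneratedCMPointed hP hV)

/-- **Row 4 — W6-loc, 6.12 discharged**: `HC_CM`, CM-pointed δ-families and the LOCAL germ at CM fibres (the output
shape of strict semiregularity, Buchweitz–Flenner Thm. 5.1/5.2 — not Question 11.4 sentence 2, refuted in dim ≥ 3).
Twin of `hodgeGeneralWeilTypeComponent_of_HC_CM_local`. [cite: vanGeemen1994HodgeAV, Thm. 6.12]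
[cite: BuchweitzFlenner2003, Thm. 5.1] -/
theorem hodgeGeneralWeilTypeComponent_of_HC_CM_local_discharged (hCM : Theses.RankFourFaces.CMAbelianHodge)
    (hn : 0 < n) (hd : 0 < d) (hP : CMPointedWeilFamiliesComponent n d δ) (hL : LocalWeilVHCAtCMComponent n d δ) :
    HodgeGeneralWeilTypeComponent n d δ :=
  hodgeGeneralWeilTypeComponent_of_weilClassesComponent_discharged hn hd
    (weilClassesComponent_of_HC_CM_local hCM hP hL)

/-- **Row 5 — W6′-loc WITHOUT `HC_CM`, 6.12 discharged.** Twin of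
`hodgeGeneralWeilTypeComponent_of_divisorGeneratedCMPointed_localCM`. [cite: vanGeemen1994HodgeAV, 5.5 and Thm. 6.12] -/
theorem hodgeGeneralWeilTypeComponent_of_divisorGeneratedCMPointed_localCM_discharged (hn : 0 < n) (hd : 0 < d)
    (hP : DivisorGeneratedCMPointedWeilFamiliesComponent n d δ) (hL : LocalWeilVHCAtCMComponent n d δ) :
    HodgeGeneralWeilTypeComponent n d δ :=
  hodgeGeneralWeilTypeComponent_of_weilClassesComponent_discharged hn hd
    (weilClassesComponent_of_divisorGeneratedCMPointed_localCM hP hL)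

/-- **Row 6 — W6‴ WITHOUT `HC_CM`, 6.12 discharged**: CM-power-pointed δ-families (the anchor `E_Kⁿ × E_Kⁿ`-type fibre is
validated by Tate's theorem, part VIII) and the δ-restricted variational statement. Twin of
`hodgeGeneralWeilTypeComponent_of_cmPowerPointed`. [cite: vanGeemen1994HodgeAV, Thm. 6.12 and Thm. 4.3] -/
theorem hodgeGeneralWeilTypeComponent_of_cmPowerPointed_discharged (hn : 0 < n) (hd : 0 < d)
    (hP : CMPowerPointedWeilFamiliesComponent n d δ) (hV : WeilVariationalHodgeComponent n d δ) :
    HodgeGeneralWeilTypeComponent n d δ :=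
  hodgeGeneralWeilTypeComponent_of_weilClassesComponent_discharged hn hd
    (weilClassesComponent_of_cmPowerPointed hP hV)

/-! ### §2 The general-member POWER cells — rows 7–17
(PW0 `hAbd` stays: a refereed theorem in print, typed, unproved in the tree) -/

/-- **Row 7 — PW2, 6.12 discharged**: the component's Weil-class target gives its general-member power cell, modulo
PW0. Twin of `hodgePowersOfGeneralWeilTypeComponent_of_weilClassesComponent`.
[cite: vanGeemen1994HodgeAV, Thm. 4.11 and Thm. 6.12] [cite: Abdulali2016TateTwists, Thm. 4.1] -/
theorem hodgePowersOfGeneralWeilTypeComponent_of_weilClassesComponent_discharged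
    (hAbd : UsualHodgePowersOfGeneralWeilType) (hn : 0 < n) (hd : 0 < d) (hW : WeilClassesComponent n d δ) :
    HodgePowersOfGeneralWeilTypeComponent n d δ :=
  hodgePowersOfGeneralWeilTypeComponent_of_hodgeGeneralWeilTypeComponent hAbd hn hd
    (hodgeGeneralWeilTypeComponent_of_weilClassesComponent_discharged hn hd hW)

/-- **Row 8 — PW3 `HC_<powers of the general member>_of_HC_CM`, 6.12 discharged** (`HC_CM` nominal, rows 9 and the
CM-power anchors). Twin of `HC_PowersOfGeneralWeilTypeComponent_of_HC_CM`.
[cite: vanGeemen1994HodgeAV, Thm. 6.12 and 5.5] [cite: Abdulali2016TateTwists, Thm. 4.1] -/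
theorem HC_PowersOfGeneralWeilTypeComponent_of_HC_CM_discharged (hCM : Theses.RankFourFaces.CMAbelianHodge)
    (hAbd : UsualHodgePowersOfGeneralWeilType) (hn : 0 < n) (hd : 0 < d)
    (hP : CMPointedWeilFamiliesComponent n d δ) (hV : WeilVariationalHodgeComponent n d δ) :
    HodgePowersOfGeneralWeilTypeComponent n d δ :=
  hodgePowersOfGeneralWeilTypeComponent_of_hodgeGeneralWeilTypeComponent hAbd hn hd
    (HC_GeneralWeilTypeComponent_of_HC_CM_discharged hCM hn hd hP hV)

/-- **Row 9 — PW3′ WITHOUT `HC_CM`, 6.12 discharged.** Twin of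
`hodgePowersOfGeneralWeilTypeComponent_of_divisorGeneratedCMPointed`.
[cite: vanGeemen1994HodgeAV, Thm. 6.12 and 5.5] [cite: Abdulali2016TateTwists, Thm. 4.1] -/
theorem hodgePowersOfGeneralWeilTypeComponent_of_divisorGeneratedCMPointed_discharged
    (hAbd : UsualHodgePowersOfGeneralWeilType) (hn : 0 < n) (hd : 0 < d)
    (hP : DivisorGeneratedCMPointedWeilFamiliesComponent n d δ) (hV : WeilVariationalHodgeComponent n d δ) :
    HodgePowersOfGeneralWeilTypeComponent n d δ :=
  hodgePowersOfGeneralWeilTypeComponent_of_hodgeGeneralWeilTypeComponent hAbd hn hd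
    (hodgeGeneralWeilTypeComponent_of_divisorGeneratedCMPointed_discharged hn hd hP hV)

/-- **Row 10 — PW4 (survey App. A 1(b)(i)), 6.12 discharged: every power of the GENERAL abelian fourfold of Weil type
over `ℚ(i)` or `ℚ(√-3)`, every δ** — from the habitat seat's refereed fourfold cells (Schoen 1998 / Koike 2004 BY NAME)
and PW0. Twin of `hodgePowersOfGeneralWeilTypeComponent_two_of_refereed_one_or_three`.
[cite: Abdulali2016TateTwists, App. A 1(b)(i) and Thm. 4.1] [cite: Schoen1998HodgeWeilAddendum, Theorem (p. 329)]
[cite: Koike2004WeilHodge, Remark 2.1] -/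
theorem hodgePowersOfGeneralWeilTypeComponent_two_of_refereed_one_or_three_discharged
    (hAbd : UsualHodgePowersOfGeneralWeilType) (hK : Koike2004_weilClasses_algebraic_hyperbolicSixfold_one)
    (hS : Schoen1998_weilClasses_algebraic_hyperbolicSixfold_three) {d : ℕ} (hd13 : d = 1 ∨ d = 3)
    (δ : weilNormResidueGroup d) : HodgePowersOfGeneralWeilTypeComponent 2 d δ :=
  hodgePowersOfGeneralWeilTypeComponent_of_weilClassesComponent_discharged hAbd two_pos
    (by rcases hd13 with rfl | rfl <;> norm_num)
    (Summit.HodgeConjecture.HodgeConjecture.Ring2.Habitat.weilClassesComponent_two_of_refereed_one_or_three hK hS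
      hd13 δ)

/-- **Row 11 — PW5, `K = ℚ(√-3)`, 6.12 discharged** (Landherr binder kept as in PW5; row 15 drops it). Twin of
`hodgePowersOfGeneralWeilTypeComponent_split_three_three_of_schoen`.
[cite: Abdulali2016TateTwists, App. A 1(b)(ii)] [cite: Schoen1998HodgeWeilAddendum] [cite: vanGeemen1994HodgeAV, (5.4.1)] -/
theorem hodgePowersOfGeneralWeilTypeComponent_split_three_three_of_schoen_discharged
    (hAbd : UsualHodgePowersOfGeneralWeilType) (hL : LandherrSplitCriterion)
    (hS : Schoen1998_weilClasses_algebraic_hyperbolicSixfold_three) :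
    HodgePowersOfGeneralWeilTypeComponent 3 3 (splitDiscriminantClass 3 3) :=
  hodgePowersOfGeneralWeilTypeComponent_of_weilClassesComponent_discharged hAbd three_pos three_pos
    (weilClassesComponent_split_three_three_of_schoen hL hS)

/-- **Row 12 — PW5, `K = ℚ(i)`, 6.12 discharged.** Twin of `hodgePowersOfGeneralWeilTypeComponent_split_three_one_of_koike`.
[cite: Abdulali2016TateTwists, App. A 1(b)(ii)] [cite: Koike2004WeilHodge, Thm. 2.1 and Cor. 2.1] -/
theorem hodgePowersOfGeneralWeilTypeComponent_split_three_one_of_koike_discharged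
    (hAbd : UsualHodgePowersOfGeneralWeilType) (hL : LandherrSplitCriterion)
    (hK : Koike2004_weilClasses_algebraic_hyperbolicSixfold_one) :
    HodgePowersOfGeneralWeilTypeComponent 3 1 (splitDiscriminantClass 3 1) :=
  hodgePowersOfGeneralWeilTypeComponent_of_weilClassesComponent_discharged hAbd three_pos one_pos
    (weilClassesComponent_split_three_one_of_koike hL hK)

/-- **Row 13 — PW5, every `d`, from the UNREFEREED floor fact F2, 6.12 discharged.** Twin of
`hodgePowersOfGeneralWeilTypeComponent_split_three_of_markmanSixfolds`.
[cite: Markman2025SecantWeil, Thm. 1.5.1 (preprint, unrefereed)] [cite: Abdulali2016TateTwists, Thm. 4.1] -/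
theorem hodgePowersOfGeneralWeilTypeComponent_split_three_of_markmanSixfolds_discharged
    (hAbd : UsualHodgePowersOfGeneralWeilType) (hL : LandherrSplitCriterion)
    (hM : Markman2025_weilClasses_algebraic_hyperbolicSixfold) {d : ℕ} (hd : 0 < d) :
    HodgePowersOfGeneralWeilTypeComponent 3 d (splitDiscriminantClass 3 d) :=
  hodgePowersOfGeneralWeilTypeComponent_of_weilClassesComponent_discharged hAbd three_pos hd
    (weilClassesComponent_split_three_of_markmanSixfolds hL hM hd)

/-- **Row 14 — PW4′, every fourfold component, from the UNREFEREED floor fact F1, 6.12 discharged.** Twin of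
`hodgePowersOfGeneralWeilTypeComponent_two_of_markmanFourfolds`.
[cite: Markman2025SecantWeil, Cor. 1.6.1 (preprint, unrefereed)] [cite: Abdulali2016TateTwists, Thm. 4.1] -/
theorem hodgePowersOfGeneralWeilTypeComponent_two_of_markmanFourfolds_discharged
    (hAbd : UsualHodgePowersOfGeneralWeilType) (hM : Markman2025_weilClasses_algebraic_abelianFourfold) {d : ℕ}
    (hd : 0 < d) (δ : weilNormResidueGroup d) : HodgePowersOfGeneralWeilTypeComponent 2 d δ :=
  hodgePowersOfGeneralWeilTypeComponent_of_weilClassesComponent_discharged hAbd two_pos hd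
    (weilClassesComponent_two_of_markmanFourfolds hM hd δ)

/-- **Row 15 — L3 with BOTH Landherr and 6.12 discharged: every power of the GENERAL split abelian sixfold of Weil type
over `ℚ(√-3)`, from PW0 and Schoen's refereed fact only.** Twin of
`hodgePowersOfGeneralWeilTypeComponent_split_three_three_of_schoen'`.
[cite: Abdulali2016TateTwists, App. A 1(b)(ii) and Thm. 4.1] [cite: Schoen1998HodgeWeilAddendum] -/
theorem hodgePowersOfGeneralWeilTypeComponent_split_three_three_of_schoen'_discharged
    (hAbd : UsualHodgePowersOfGeneralWeilType) (hS : Schoen1998_weilClasses_algebraic_hyperbolicSixfold_three) :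
    HodgePowersOfGeneralWeilTypeComponent 3 3 (splitDiscriminantClass 3 3) :=
  hodgePowersOfGeneralWeilTypeComponent_split_three_three_of_schoen_discharged hAbd landherrSplitCriterion_holds hS

/-- **Row 16 — L4 with both binders discharged: every power of the GENERAL split sixfold of Weil type over `ℚ(i)`, from
PW0 and Koike 2004 only.** Twin of `hodgePowersOfGeneralWeilTypeComponent_split_three_one_of_koike'`.
[cite: Abdulali2016TateTwists, App. A 1(b)(ii) and Thm. 4.1] [cite: Koike2004WeilHodge, Thm. 2.1 and Cor. 2.1] -/
theorem hodgePowersOfGeneralWeilTypeComponent_split_three_one_of_koike'_discharged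
    (hAbd : UsualHodgePowersOfGeneralWeilType) (hK : Koike2004_weilClasses_algebraic_hyperbolicSixfold_one) :
    HodgePowersOfGeneralWeilTypeComponent 3 1 (splitDiscriminantClass 3 1) :=
  hodgePowersOfGeneralWeilTypeComponent_split_three_one_of_koike_discharged hAbd landherrSplitCriterion_holds hK

/-- **Row 17 — L5 with both binders discharged, from the UNREFEREED floor fact F2.** Twin of
`hodgePowersOfGeneralWeilTypeComponent_split_three_of_markmanSixfolds'`.
[cite: Markman2025SecantWeil, Thm. 1.5.1 (preprint, unrefereed)] [cite: Abdulali2016TateTwists, Thm. 4.1] -/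
theorem hodgePowersOfGeneralWeilTypeComponent_split_three_of_markmanSixfolds'_discharged
    (hAbd : UsualHodgePowersOfGeneralWeilType) (hM : Markman2025_weilClasses_algebraic_hyperbolicSixfold) {d : ℕ}
    (hd : 0 < d) : HodgePowersOfGeneralWeilTypeComponent 3 d (splitDiscriminantClass 3 d) :=
  hodgePowersOfGeneralWeilTypeComponent_split_three_of_markmanSixfolds_discharged hAbd landherrSplitCriterion_holds
    hM hd

/-! ### §3 The `n = 1` column of the δ-tables, OUTRIGHT (abelian surfaces: `dim ≤ 3`) -/

/-- **`W(1, d, δ)` holds unconditionally**: a rational `(1,1)` Weil class on an abelian SURFACE is a divisor class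
(Lefschetz `(1,1)`; in the tree, the Hodge conjecture in dimension `≤ 3`). [cite: VoisinHodgeII2003, §10.2.3 proof of Prop. 10.26]
[cite: Deligne2000, §1] -/
theorem weilClassesComponent_one (d : ℕ) (δ : weilNormResidueGroup d) : WeilClassesComponent 1 d δ :=
  fun _ _ _ hX _ _ _ _ _ _ c hc hnn _ ↦ (hodgeConjectureFor_of_dim_le_three_holds (by norm_num) hX).2 1 c hc hnn

/-- **`T6(1, d, δ)` holds unconditionally** (`dim A = 2 ≤ 3`; no 6.12, which is false at `n = 1` in its `Disjoint` form,
and no `SU_H` hypothesis is used). [cite: VoisinHodgeII2003, §10.2.3 proof of Prop. 10.26] [cite: vanGeemen1994HodgeAV, Thm. 4.11] -/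
theorem hodgeGeneralWeilTypeComponent_one (d : ℕ) (δ : weilNormResidueGroup d) :
    HodgeGeneralWeilTypeComponent 1 d δ :=
  fun A _ _ _ hA _ _ _ _ _ _ ↦
    hodgeConjectureFor_of_dim_le_three_holds (n := A.dim) (by omega)
      (AbelianVariety.isSmoothProjective_holds (A := A))

/-! ### §4 Audit -/

/-- **VAN GEEMEN 6.12 BINDER LEDGER, audit**: the T6(δ) engine, the two `HC_CM`-free T6(δ) rows, the power-cell engine
and the three fully binder-free refereed power cells hold with NO `h612` (and no Landherr binder); `h612` itself implies
the proved corrected statement. [cite: vanGeemen1994HodgeAV, Thm. 6.12] [cite: Abdulali2016TateTwists, Thm. 4.1] -/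
theorem thm612_binder_ledger :
    (VanGeemen1994_thm612 → VanGeemen1994_thm612_corrected) ∧ VanGeemen1994_thm612_corrected ∧
      (∀ (n d : ℕ) (δ : weilNormResidueGroup d), 0 < n → 0 < d →
        WeilClassesComponent n d δ → HodgeGeneralWeilTypeComponent n d δ) ∧
      (∀ (n d : ℕ) (δ : weilNormResidueGroup d), 0 < n → 0 < d →
        DivisorGeneratedCMPointedWeilFamiliesComponent n d δ → WeilVariationalHodgeComponent n d δ →
          HodgeGeneralWeilTypeComponent n d δ) ∧
      (∀ (n d : ℕ) (δ : weilNormResidueGroup d), 0 < n → 0 < d →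
        CMPowerPointedWeilFamiliesComponent n d δ → WeilVariationalHodgeComponent n d δ →
          HodgeGeneralWeilTypeComponent n d δ) ∧
      (UsualHodgePowersOfGeneralWeilType → ∀ (n d : ℕ) (δ : weilNormResidueGroup d), 0 < n → 0 < d →
        WeilClassesComponent n d δ → HodgePowersOfGeneralWeilTypeComponent n d δ) ∧
      (UsualHodgePowersOfGeneralWeilType → Schoen1998_weilClasses_algebraic_hyperbolicSixfold_three →
        HodgePowersOfGeneralWeilTypeComponent 3 3 (splitDiscriminantClass 3 3)) ∧
      (UsualHodgePowersOfGeneralWeilType → Koike2004_weilClasses_algebraic_hyperbolicSixfold_one →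
        HodgePowersOfGeneralWeilTypeComponent 3 1 (splitDiscriminantClass 3 1)) ∧
      (∀ (d : ℕ) (δ : weilNormResidueGroup d), WeilClassesComponent 1 d δ ∧ HodgeGeneralWeilTypeComponent 1 d δ) :=
  ⟨vanGeemen1994_thm612_corrected_of_thm612, VanGeemen1994_thm612_corrected_holds,
    fun _ _ _ hn hd hW ↦ hodgeGeneralWeilTypeComponent_of_weilClassesComponent_discharged hn hd hW,
    fun _ _ _ hn hd hP hV ↦ hodgeGeneralWeilTypeComponent_of_divisorGeneratedCMPointed_discharged hn hd hP hV,
    fun _ _ _ hn hd hP hV ↦ hodgeGeneralWeilTypeComponent_of_cmPowerPointed_discharged hn hd hP hV,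
    fun hAbd _ _ _ hn hd hW ↦
      hodgePowersOfGeneralWeilTypeComponent_of_weilClassesComponent_discharged hAbd hn hd hW,
    fun hAbd hS ↦ hodgePowersOfGeneralWeilTypeComponent_split_three_three_of_schoen'_discharged hAbd hS,
    fun hAbd hK ↦ hodgePowersOfGeneralWeilTypeComponent_split_three_one_of_koike'_discharged hAbd hK,
    fun d δ ↦ ⟨weilClassesComponent_one d δ, hodgeGeneralWeilTypeComponent_one d δ⟩⟩

/-- ON-PATH, audit: every conclusion of this file is a case of the summit. [cite: Deligne2000, §1] -/
theorem thm612_binder_ledger_of_hodgeConjecture (h : _root_.HodgeConjecture) (n d : ℕ)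
    (δ : weilNormResidueGroup d) :
    HodgeGeneralWeilTypeComponent n d δ ∧ HodgePowersOfGeneralWeilTypeComponent n d δ ∧
      WeilClassesComponent n d δ :=
  ⟨hodgeGeneralWeilTypeComponent_of_hodgeConjecture h n d δ,
    hodgePowersOfGeneralWeilTypeComponent_of_hodgeConjecture h n d δ, weilClassesComponent_of_hodgeConjecture h n d δ⟩

end Summit.HodgeConjecture.HodgeConjecture.Ring2.Hypotheses

end
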